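import Summits.Ventures.PercRepro.S2TenCaps
import Summits.Ventures.PercRepro.S2TailCell
import Summits.Ventures.PercRepro.S2DichotomyTools
import Summits.Ventures.PercRepro.S2CoindepCount
import Summits.Ventures.PercRepro.S2SpanningCount

/-!
# PercRepro — S2: THE CASE `ν = 9` OF THE COLOOP-FREE CELL `(13, 10)` (p7, gen 19; sub-claim S2; the row `p = 13`)

The case `ν = 9 = d − 1` (a set of nullity `9` on `≤ 15` points) by the kit's hitting counts against the kit's tail at `(13, 10)` on the caps
`20 / 167 / 1293` (its rank part is exactly `543672219949261 / 1007924400`): `#U ≤ 246870`, `#spanning ≤ 253419`, `m = 97`, ratio `0.90` —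
**`c025_thirteen_ten_cf_nu_nine`**. Nothing about the cell is claimed. Axioms: standard.
-/

open scoped Matroid

namespace PercRepro

namespace ThmN

open Set

variable {α : Type}

/-- The tail side of the cell `(13, 10)` on the caps `20 / 167 / 1293` with the spanning count `S` a parameter: the rank-`≤ 5` part
of the kit's tail is exactly `543672219949261 / 1007924400`. -/
theorem tail_thirteen_ten_cf (S m : ℕ) (h : (1024 : ℚ) * ((543672219949261 / 1007924400 : ℚ) + (S : ℚ)) ≤ (m : ℚ) * 2 ^ 23) :
    1024 * ((((13 + 10).choose 4 : ℚ) +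
      (∑ j ∈ Finset.range 6, (Nat.choose (min 5 ((10 + 3) / 2 + 1 - 2)) j : ℚ) / (((j + 1) + 3 * (j + 1).choose 2 + 3 * (j + 1).choose 3 + 2 * (j + 1).choose 4 : ℕ) : ℚ)) *
        ((20 * (13 + 10 - 3).choose 2 + 167 * (13 + 10 - 4) + 1293 : ℕ) : ℚ) +
      ((∑ j ∈ Finset.range 6, (Nat.choose 5 j : ℚ) / (((j + 1) + 3 * (j + 1).choose 2 + 3 * (j + 1).choose 3 + 2 * (j + 1).choose 4 : ℕ) : ℚ)) -
        (∑ j ∈ Finset.range 6, (Nat.choose (min 5 ((10 + 3) / 2 + 1 - 2)) j : ℚ) / (((j + 1) + 3 * (j + 1).choose 2 + 3 * (j + 1).choose 3 + 2 * (j + 1).choose 4 : ℕ) : ℚ))) *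
        ((10 : ℕ).choose 5 : ℚ)) +
      (((13 + 10).choose 3 * 2 ^ 3 + (13 + 10).choose 2 * 2 + (13 + 10) + 1 : ℕ) : ℚ) +
      (((13 + 10).choose 5 : ℚ) + (∑ j ∈ Finset.range (10), (Nat.choose (min 13 ((10 + 6) / 2 + 1 - 2)) j : ℚ) / (((j + 1) + 3 * (j + 1).choose 2 + 3 * (j + 1).choose 3 + 2 * (j + 1).choose 4 : ℕ) : ℚ)) * ((20 * (13 + 10 - 3).choose 3 + 167 * (13 + 10 - 4).choose 2 + 1293 * (13 + 10 - 5) + (10 + 5).choose 6 : ℕ) : ℚ) +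
        ((∑ j ∈ Finset.range (10), (Nat.choose (min 19 (5 + 10) - 6) j : ℚ) / (((j + 1) + 3 * (j + 1).choose 2 + 3 * (j + 1).choose 3 + 2 * (j + 1).choose 4 : ℕ) : ℚ)) - (∑ j ∈ Finset.range (10), (Nat.choose (min 13 ((10 + 6) / 2 + 1 - 2)) j : ℚ) / (((j + 1) + 3 * (j + 1).choose 2 + 3 * (j + 1).choose 3 + 2 * (j + 1).choose 4 : ℕ) : ℚ))) *
        ((min 19 (5 + 10)).choose 6 : ℚ)) +
      (S : ℚ)) ≤ (m : ℚ) * 2 ^ (13 + 10) := by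
  have hsm : (∑ j ∈ Finset.range (10), (Nat.choose (min 13 ((10 + 6) / 2 + 1 - 2)) j : ℚ) / (((j + 1) + 3 * (j + 1).choose 2 + 3 * (j + 1).choose 3 + 2 * (j + 1).choose 4 : ℕ) : ℚ)) = 6418141 / 1184400 := by
    norm_num [Finset.sum_range_succ, Nat.choose]
  have hsg : (∑ j ∈ Finset.range (10), (Nat.choose (min 19 (5 + 10) - 6) j : ℚ) / (((j + 1) + 3 * (j + 1).choose 2 + 3 * (j + 1).choose 3 + 2 * (j + 1).choose 4 : ℕ) : ℚ)) = 295528511 / 27997900 := by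
    norm_num [Finset.sum_range_succ, Nat.choose]
  have hs4m : (∑ j ∈ Finset.range 6, (Nat.choose (min 5 ((10 + 3) / 2 + 1 - 2)) j : ℚ) / (((j + 1) + 3 * (j + 1).choose 2 + 3 * (j + 1).choose 3 + 2 * (j + 1).choose 4 : ℕ) : ℚ)) = 12767 / 4230 := by
    norm_num [Finset.sum_range_succ, Nat.choose]
  have hs4g : (∑ j ∈ Finset.range 6, (Nat.choose 5 j : ℚ) / (((j + 1) + 3 * (j + 1).choose 2 + 3 * (j + 1).choose 3 + 2 * (j + 1).choose 4 : ℕ) : ℚ)) = 12767 / 4230 := by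
    norm_num [Finset.sum_range_succ, Nat.choose]
  rw [hsm, hsg, hs4m, hs4g]
  norm_num [Nat.choose] at h ⊢
  linarith

/-- **The case `ν = 9` of the coloop-free cell `(13, 10)`**: a set of nullity `9` on `≤ 15` points, by the kit's hitting counts
(`#U ≤ 246870`, `#spanning ≤ 253419`, `m = 97`). -/
theorem c025_thirteen_ten_cf_nu_nine (M : Matroid α) [M.Finite]
    (hR : M.eRank = ((13 : ℕ) : ℕ∞)) (hn : M.E.ncard = 13 + 10)
    (hfree : ∀ e ∈ M.E, ∃ A ⊆ M.E \ {e}, e ∉ M.closure A ∧ e ∉ M.closure ((M.E \ {e}) \ A)) (hK : ∀ e, ¬ M.IsColoop e)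
    (h9 : ∃ W ⊆ M.E, W.ncard ≤ 15 ∧ W.encard = M.eRk W + 9) :
    RLS M 13 5 := by
  classical
  have hd : M.E.encard = M.eRank + ((10 : ℕ) : ℕ∞) := by
    rw [hR, ← M.ground_finite.cast_ncard_eq, hn]
    push_cast
    ring
  obtain ⟨hs3, hs4, hs5⟩ := caps_thirteen_ten_cf M hd hn hfree hK
  obtain ⟨W, hW, hWn, hWk⟩ := h9
  have full : Matroid.topCount M 13 5 ≤ ∑ m ∈ Finset.Icc 5 10, ∑ j ∈ Finset.Icc (m + 9 - 10) m,
      W.ncard.choose j * (13 + 10 - W.ncard).choose (m - j) := by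
    refine (S2.topCount_le_sum_spanning M hR hd 5).trans ?_
    refine Finset.sum_le_sum (fun m _ => ?_)
    have h := S2.ncard_spanning_compl_le_of_nullity M hW hd hWk (m := m)
    rw [hn] at h
    exact h
  have hU' : Matroid.topCount M 13 5 ≤ 246870 := by
    refine full.trans ?_
    generalize W.ncard = w at hWn ⊢
    interval_cases w <;> decide
  have hS' : {X : Set α | X ⊆ M.E ∧ M.eRk X = M.eRank}.ncard ≤ 253419 := by
    refine (S2.ncard_spanning_le_of_nullity M hW hd hWk).trans ?_
    rw [hn]
    generalize W.ncard = w at hWn ⊢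
    interval_cases w <;> decide
  rw [RLS_iff]
  exact c025_core_five_cell_of_topCount_spanning_xqictq5g M 13 10 (by norm_num) hR hn hfree 20 167 1293 hs3 hs4 hs5 246870 hU'
    253419 hS' 9480 (by norm_num) (phiK 13 5) (by rw [phiK_thirteen_five]; norm_num)
    ⟨97, by norm_num, by norm_num, tail_thirteen_ten_cf 253419 97 (by norm_num)⟩

end ThmN

end PercRepro
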